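import Literature.MathematicalPhysics.QuantumFieldTheory.BalabanRegulatorChart

/-!
# Stub `stub_realisation` of the line `perfect-action-regulator-chart` (crux `BalabanStepParabolic`)

Route `ParabolicTrajectory` of `YangMills`, crux item `stmt-QuantumFields-9684`. This file proves the
realisation bridge of the registered skeleton: the verbatim Lipschitz hypothesis block
`ParabolicBlock E φ Ψ A (b₀ log M) C δ`, the basin clauses `BasinBlock E φ Ψ (b₀ log M) C δ R θ'`
(with `2 ≤ M`, `0 < b₀`, `‖A‖ ≤ θ < 1`, `0 < C`, `0 < δ ≤ R`, `0 ≤ θ' < 1`) and chart realisation data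
`ChartRealisationData G r M E φ Ψ δ R yW g₀ betaOf κ K corr` (curvature strings only, covariance only
inside the chart) inhabit `BalabanBanachStep G r M`.

## Construction

* Extended chart `Ê = E × (ℝ × E)` (sup norm), `φ̂ g q = φ g q.1`, `Ψ̂ g q = (Ψ g q.1, (g²/2, q.1/2))`,
  `Â q = (A q.1, (0, q.1/2))`, constants `max θ ½`, `max C ½`, `max θ' ½`: the extra coordinates
  record the pre-image `(g, q.1)` of an orbit point (the step becomes injective on what the
  observables see) at the price of harmless `O(g²)` / contraction-`½` terms in the verbatim block.
* Normalisations `c g s = 𝟙[s = r.curvature]`; `expect p S n σ f` = `0` on strings with a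
  non-curvature entry (both sides of (4b) vanish: a zero-normalised smeared field kills the Wilson
  integrand); on curvature strings = `corr (p.1, p.2.1) S n f` when `(p.1, p.2.1)` lies in the chart
  `[0, δ] × B̄_R`, else the DECODED value `corr (√(2 p.2.2.1), 2 p.2.2.2) (M S) n (blockDilate M ∘ f)`
  read off the recorded pre-image — exactly what (4a) demands at image points leaving the chart,
  while (4b), (4c) only ever see in-chart points.
-/

open scoped SchwartzMap
open MeasureTheory Literature.MathematicalPhysics.AQFT Literature.MathematicalPhysics.QuantumLattice
  Literature.Probability.LatticeModels Literature.MathematicalPhysics.QuantumFieldTheory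

noncomputable section

namespace Summit.QuantumFields.YangMills.Theorems.BalabanStepParabolic

/-! ### Chart clauses on the extended chart `E × (ℝ × E)` -/

section Chart

variable {E : Type} [NormedAddCommGroup E] [NormedSpace ℝ E]

omit [NormedSpace ℝ E] in
/-- Sup norm of a triple: bounded by a common bound of the three components. [folklore] -/
private theorem norm_triple_le {a c : E} {s K : ℝ} (ha : ‖a‖ ≤ K) (hs : |s| ≤ K) (hc : ‖c‖ ≤ K) :
    ‖(a, (s, c))‖ ≤ K := by
  rw [Prod.norm_mk, Prod.norm_mk, Real.norm_eq_abs]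
  exact max_le ha (max_le hs hc)

/-- `‖Â‖ ≤ max θ ½` for `Â q = (A q.1, (0, q.1/2))`, `‖A‖ ≤ θ`. [folklore] -/
private theorem hat_norm_A_le {A : E →L[ℝ] E} {θ : ℝ} (hθ : 0 ≤ θ) (hA : ‖A‖ ≤ θ)
    (Â : (E × (ℝ × E)) →L[ℝ] (E × (ℝ × E))) (hÂ : ∀ q, Â q = (A q.1, (0, (1 / 2 : ℝ) • q.1))) :
    ‖Â‖ ≤ max θ (1 / 2) := by
  refine ContinuousLinearMap.opNorm_le_bound _ (le_max_of_le_left hθ) fun q => ?_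
  rw [hÂ]
  have h1 : ‖q.1‖ ≤ ‖q‖ := norm_fst_le q
  have hq : 0 ≤ ‖q‖ := norm_nonneg q
  have hm : 0 ≤ max θ (1 / 2) := le_max_of_le_left hθ
  refine norm_triple_le ?_ ?_ ?_
  · calc ‖A q.1‖ ≤ ‖A‖ * ‖q.1‖ := A.le_opNorm q.1
      _ ≤ θ * ‖q‖ := mul_le_mul hA h1 (norm_nonneg _) hθ
      _ ≤ max θ (1 / 2) * ‖q‖ := mul_le_mul_of_nonneg_right (le_max_left _ _) hq
  · rw [abs_zero]; exact mul_nonneg hm hq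
  · rw [norm_smul, Real.norm_eq_abs, abs_of_pos (by norm_num : (0 : ℝ) < 1 / 2)]
    calc (1 / 2 : ℝ) * ‖q.1‖ ≤ (1 / 2) * ‖q‖ := by gcongr
      _ ≤ max θ (1 / 2) * ‖q‖ := mul_le_mul_of_nonneg_right (le_max_right _ _) hq

variable {φ : ℝ → E → ℝ} {Ψ : ℝ → E → E} {A : E →L[ℝ] E} {b C δ R θ' : ℝ}

/-- Field `remainder` on the extended chart. [folklore] -/
private theorem hat_remainder (hP : ParabolicBlock E φ Ψ A b C δ)
    (Â : (E × (ℝ × E)) →L[ℝ] (E × (ℝ × E))) (hÂ : ∀ q, Â q = (A q.1, (0, (1 / 2 : ℝ) • q.1)))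
    (g : ℝ) (q : E × (ℝ × E)) (hg : |g| ≤ δ) (hq : ‖q‖ ≤ δ) :
    |φ g q.1 - (g + b * g ^ 3)| ≤ max C (1 / 2) * (g ^ 4 + |g| ^ 3 * ‖q‖) ∧
      ‖(Ψ g q.1, ((1 / 2 : ℝ) * g ^ 2, (1 / 2 : ℝ) • q.1)) - Â q‖ ≤
        max C (1 / 2) * (g ^ 2 + ‖q‖ ^ 2) := by
  have h1 : ‖q.1‖ ≤ ‖q‖ := norm_fst_le q
  have hCle : C ≤ max C (1 / 2) := le_max_left _ _
  have hεle : (1 / 2 : ℝ) ≤ max C (1 / 2) := le_max_right _ _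
  have hm : 0 ≤ max C (1 / 2) := le_max_of_le_right (by norm_num)
  obtain ⟨hφ, hΨ⟩ := hP.1 g q.1 hg (h1.trans hq)
  refine ⟨?_, ?_⟩
  · calc |φ g q.1 - (g + b * g ^ 3)| ≤ C * (g ^ 4 + |g| ^ 3 * ‖q.1‖) := hφ
      _ ≤ max C (1 / 2) * (g ^ 4 + |g| ^ 3 * ‖q‖) := by gcongr
  · rw [hÂ, Prod.mk_sub_mk, Prod.mk_sub_mk, sub_zero, sub_self]
    refine norm_triple_le ?_ ?_ ?_
    · calc ‖Ψ g q.1 - A q.1‖ ≤ C * (g ^ 2 + ‖q.1‖ ^ 2) := hΨ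
        _ ≤ max C (1 / 2) * (g ^ 2 + ‖q‖ ^ 2) := by gcongr
    · rw [abs_of_nonneg (by positivity)]
      calc (1 / 2 : ℝ) * g ^ 2 ≤ max C (1 / 2) * g ^ 2 := by gcongr
        _ ≤ max C (1 / 2) * (g ^ 2 + ‖q‖ ^ 2) :=
          mul_le_mul_of_nonneg_left (le_add_of_nonneg_right (by positivity)) hm
    · rw [norm_zero]; positivity

/-- Field `lipschitz_fibre` on the extended chart (the two extra components cancel). [folklore] -/
private theorem hat_lipschitz_fibre (hP : ParabolicBlock E φ Ψ A b C δ)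
    (Â : (E × (ℝ × E)) →L[ℝ] (E × (ℝ × E))) (hÂ : ∀ q, Â q = (A q.1, (0, (1 / 2 : ℝ) • q.1)))
    (g : ℝ) (q q' : E × (ℝ × E)) (hg : |g| ≤ δ) (hq : ‖q‖ ≤ δ) (hq' : ‖q'‖ ≤ δ) :
    |φ g q.1 - φ g q'.1| ≤ max C (1 / 2) * |g| ^ 3 * ‖q - q'‖ ∧
      ‖(Ψ g q.1, ((1 / 2 : ℝ) * g ^ 2, (1 / 2 : ℝ) • q.1)) -
          (Ψ g q'.1, ((1 / 2 : ℝ) * g ^ 2, (1 / 2 : ℝ) • q'.1)) - Â (q - q')‖ ≤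
        max C (1 / 2) * (|g| + ‖q‖ + ‖q'‖) * ‖q - q'‖ := by
  have h1 : ‖q.1‖ ≤ ‖q‖ := norm_fst_le q
  have h1' : ‖q'.1‖ ≤ ‖q'‖ := norm_fst_le q'
  have hd : ‖q.1 - q'.1‖ ≤ ‖q - q'‖ := norm_fst_le (q - q')
  have hCle : C ≤ max C (1 / 2) := le_max_left _ _
  obtain ⟨hφ, hΨ⟩ := hP.2.1 g q.1 q'.1 hg (h1.trans hq) (h1'.trans hq')
  refine ⟨?_, ?_⟩
  · calc |φ g q.1 - φ g q'.1| ≤ C * |g| ^ 3 * ‖q.1 - q'.1‖ := hφ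
      _ ≤ max C (1 / 2) * |g| ^ 3 * ‖q - q'‖ := by gcongr
  · have key : (Ψ g q.1, ((1 / 2 : ℝ) * g ^ 2, (1 / 2 : ℝ) • q.1)) -
          (Ψ g q'.1, ((1 / 2 : ℝ) * g ^ 2, (1 / 2 : ℝ) • q'.1)) - Â (q - q') =
        (Ψ g q.1 - Ψ g q'.1 - A (q.1 - q'.1), ((0 : ℝ), (0 : E))) := by
      rw [hÂ]; ext <;> simp [smul_sub]
    rw [key]
    refine norm_triple_le ?_ ?_ ?_
    · calc ‖Ψ g q.1 - Ψ g q'.1 - A (q.1 - q'.1)‖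
          ≤ C * (|g| + ‖q.1‖ + ‖q'.1‖) * ‖q.1 - q'.1‖ := hΨ
        _ ≤ max C (1 / 2) * (|g| + ‖q‖ + ‖q'‖) * ‖q - q'‖ := by gcongr
    · rw [abs_zero]; positivity
    · rw [norm_zero]; positivity

/-- Field `lipschitz_base` on the extended chart (`|g² − g'²|/2 ≤ (|g| + |g'|)|g − g'|/2`). [folklore] -/
private theorem hat_lipschitz_base (hP : ParabolicBlock E φ Ψ A b C δ)
    (g g' : ℝ) (q : E × (ℝ × E)) (hg : |g| ≤ δ) (hg' : |g'| ≤ δ) (hq : ‖q‖ ≤ δ) :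
    |φ g q.1 - φ g' q.1 - (g - g') - b * (g ^ 3 - g' ^ 3)| ≤
        max C (1 / 2) * (max |g| |g'|) ^ 2 * (max |g| |g'| + ‖q‖) * |g - g'| ∧
      ‖(Ψ g q.1, ((1 / 2 : ℝ) * g ^ 2, (1 / 2 : ℝ) • q.1)) -
          (Ψ g' q.1, ((1 / 2 : ℝ) * g' ^ 2, (1 / 2 : ℝ) • q.1))‖ ≤
        max C (1 / 2) * (|g| + |g'| + ‖q‖) * |g - g'| := by
  have h1 : ‖q.1‖ ≤ ‖q‖ := norm_fst_le q
  have hCle : C ≤ max C (1 / 2) := le_max_left _ _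
  have hεle : (1 / 2 : ℝ) ≤ max C (1 / 2) := le_max_right _ _
  obtain ⟨hφ, hΨ⟩ := hP.2.2 g g' q.1 hg hg' (h1.trans hq)
  refine ⟨?_, ?_⟩
  · calc |φ g q.1 - φ g' q.1 - (g - g') - b * (g ^ 3 - g' ^ 3)|
        ≤ C * (max |g| |g'|) ^ 2 * (max |g| |g'| + ‖q.1‖) * |g - g'| := hφ
      _ ≤ max C (1 / 2) * (max |g| |g'|) ^ 2 * (max |g| |g'| + ‖q‖) * |g - g'| := by gcongr
  · rw [Prod.mk_sub_mk, Prod.mk_sub_mk, sub_self]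
    refine norm_triple_le ?_ ?_ ?_
    · calc ‖Ψ g q.1 - Ψ g' q.1‖ ≤ C * (|g| + |g'| + ‖q.1‖) * |g - g'| := hΨ
        _ ≤ max C (1 / 2) * (|g| + |g'| + ‖q‖) * |g - g'| := by gcongr
    · have hfac : (1 / 2 : ℝ) * g ^ 2 - 1 / 2 * g' ^ 2 = 1 / 2 * ((g + g') * (g - g')) := by ring
      have habs : |g + g'| ≤ |g| + |g'| + ‖q‖ :=
        (abs_add_le _ _).trans (le_add_of_nonneg_right (norm_nonneg _))
      rw [hfac, abs_mul, abs_mul, abs_of_pos (by norm_num : (0 : ℝ) < 1 / 2)]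
      calc (1 / 2 : ℝ) * (|g + g'| * |g - g'|) ≤ max C (1 / 2) * ((|g| + |g'| + ‖q‖) * |g - g'|) := by
            gcongr
        _ = max C (1 / 2) * (|g| + |g'| + ‖q‖) * |g - g'| := by ring
    · rw [norm_zero]; positivity

/-- Field `contraction` on the extended chart (rate `max θ' ½`). [folklore] -/
private theorem hat_contraction (hθ' : 0 ≤ θ') (hB : BasinBlock E φ Ψ b C δ R θ')
    (g : ℝ) (q q' : E × (ℝ × E)) (hg : |g| ≤ δ) (hq : ‖q‖ ≤ R) (hq' : ‖q'‖ ≤ R) :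
    ‖(Ψ g q.1, ((1 / 2 : ℝ) * g ^ 2, (1 / 2 : ℝ) • q.1)) -
        (Ψ g q'.1, ((1 / 2 : ℝ) * g ^ 2, (1 / 2 : ℝ) • q'.1))‖ ≤ max θ' (1 / 2) * ‖q - q'‖ := by
  have hd : ‖q.1 - q'.1‖ ≤ ‖q - q'‖ := norm_fst_le (q - q')
  have h := hB.1 g q.1 q'.1 hg ((norm_fst_le q).trans hq) ((norm_fst_le q').trans hq')
  have hm : 0 ≤ max θ' (1 / 2) := le_max_of_le_left hθ'
  rw [Prod.mk_sub_mk, Prod.mk_sub_mk, sub_self, ← smul_sub]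
  refine norm_triple_le ?_ ?_ ?_
  · calc ‖Ψ g q.1 - Ψ g q'.1‖ ≤ θ' * ‖q.1 - q'.1‖ := h
      _ ≤ max θ' (1 / 2) * ‖q - q'‖ := mul_le_mul (le_max_left _ _) hd (norm_nonneg _) hm
  · rw [abs_zero]; positivity
  · rw [norm_smul, Real.norm_eq_abs, abs_of_pos (by norm_num : (0 : ℝ) < 1 / 2)]
    exact mul_le_mul (le_max_right _ _) hd (norm_nonneg _) hm

omit [NormedSpace ℝ E] in
/-- Field `remainder_basin` on the extended chart. [folklore] -/
private theorem hat_remainder_basin (hB : BasinBlock E φ Ψ b C δ R θ')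
    (g : ℝ) (q : E × (ℝ × E)) (hg : |g| ≤ δ) (hq : ‖q‖ ≤ R) :
    |φ g q.1 - (g + b * g ^ 3)| ≤ max C (1 / 2) * (g ^ 4 + |g| ^ 3 * ‖q‖) := by
  have h1 : ‖q.1‖ ≤ ‖q‖ := norm_fst_le q
  have hCle : C ≤ max C (1 / 2) := le_max_left _ _
  calc |φ g q.1 - (g + b * g ^ 3)| ≤ C * (g ^ 4 + |g| ^ 3 * ‖q.1‖) := hB.2 g q.1 hg (h1.trans hq)
    _ ≤ max C (1 / 2) * (g ^ 4 + |g| ^ 3 * ‖q‖) := by gcongr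

end Chart

/-! ### The realisation functional: species reduction and pre-image decoding -/

section Realisation

variable {G : Type} [Group G] [TopologicalSpace G] [IsTopologicalGroup G] [CompactSpace G]
  [MeasurableSpace G] [BorelSpace G]

/-- A species string with a zero-normalised entry has vanishing centred Wilson `n`-point function:
the smeared field with multiplicative normalisation `0` is identically `0`. [folklore] -/
private theorem wilsonCentredSchwinger_eq_zero_of_c_zero {N : ℕ} (ρ : G →* Matrix (Fin N) (Fin N) ℂ)
    (β : ℝ) (L : ℕ) (c : YMSpecies G → ℝ) {n : ℕ} (σ : Fin n → YMSpecies G)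
    (f : Fin n → 𝓢(EuclideanSpace ℝ (Fin 4), ℝ)) {i : Fin n} (hi : c (σ i) = 0) :
    wilsonCentredSchwinger ρ β L c n σ f = 0 := by
  unfold wilsonCentredSchwinger
  have h : ∀ U : LGConfig 4 G, (∏ j, smearedLatticeField (σ j).F (box 4 L) 1 (c (σ j))
      (wilsonTorusMean ρ β L (σ j).F) (f j) U) = 0 := fun U =>
    Finset.prod_eq_zero (Finset.mem_univ i) (by simp [smearedLatticeField, hi])
  simp [h]

/-- The centred Wilson `n`-point function depends on the normalisations only through `c ∘ σ`. [folklore] -/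
private theorem wilsonCentredSchwinger_congr_norm {N : ℕ} (ρ : G →* Matrix (Fin N) (Fin N) ℂ)
    (β : ℝ) (L : ℕ) {c c' : YMSpecies G → ℝ} {n : ℕ} {σ : Fin n → YMSpecies G}
    (h : ∀ i, c (σ i) = c' (σ i)) (f : Fin n → 𝓢(EuclideanSpace ℝ (Fin 4), ℝ)) :
    wilsonCentredSchwinger ρ β L c n σ f = wilsonCentredSchwinger ρ β L c' n σ f := by
  unfold wilsonCentredSchwinger
  simp_rw [h]

variable {r : LatticeRep G} {M : ℕ} {E : Type} [NormedAddCommGroup E] [NormedSpace ℝ E]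
  {φ : ℝ → E → ℝ} {Ψ : ℝ → E → E} {δ R : ℝ} {yW : ℝ → E} {g₀ : ℝ} {betaOf : ℝ → ℝ} {κ K : ℝ}
  {corr : ℝ × E → ℕ → (n : ℕ) → (Fin n → 𝓢(EuclideanSpace ℝ (Fin 4), ℝ)) → ℝ}
  (hD : ChartRealisationData G r M E φ Ψ δ R yW g₀ betaOf κ K corr)
  (expect : ℝ × (E × (ℝ × E)) → ℕ → (n : ℕ) → (Fin n → YMSpecies G) →
    (Fin n → 𝓢(EuclideanSpace ℝ (Fin 4), ℝ)) → ℝ)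
  (h_in : ∀ (g : ℝ) (q : E × (ℝ × E)) (S n : ℕ) (σ : Fin n → YMSpecies G)
    (f : Fin n → 𝓢(EuclideanSpace ℝ (Fin 4), ℝ)), (∀ i, σ i = r.curvature) →
      g ∈ Set.Icc 0 δ → ‖q.1‖ ≤ R → expect (g, q) S n σ f = corr (g, q.1) S n f)
  (h_out : ∀ (g : ℝ) (q : E × (ℝ × E)) (S n : ℕ) (σ : Fin n → YMSpecies G)
    (f : Fin n → 𝓢(EuclideanSpace ℝ (Fin 4), ℝ)), (∀ i, σ i = r.curvature) →
      ¬ (g ∈ Set.Icc 0 δ ∧ ‖q.1‖ ≤ R) →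
        expect (g, q) S n σ f =
          corr (Real.sqrt (2 * q.2.1), (2 : ℝ) • q.2.2) (M * S) n (fun i => blockDilate M (f i)))
  (h_mixed : ∀ (p : ℝ × (E × (ℝ × E))) (S n : ℕ) (σ : Fin n → YMSpecies G)
    (f : Fin n → 𝓢(EuclideanSpace ℝ (Fin 4), ℝ)), ¬ (∀ i, σ i = r.curvature) → expect p S n σ f = 0)

include hD h_in h_out h_mixed in
/-- (4a) for the decoded realisation functional: inside the chart by `corr_step`, outside by reading
off the recorded pre-image; mixed strings give `0 = 0`. [folklore] -/
private theorem hat_expect_step (g : ℝ) (q : E × (ℝ × E)) (hg : g ∈ Set.Icc 0 δ) (hq : ‖q‖ ≤ R)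
    (S n : ℕ) (σ : Fin n → YMSpecies G) (f : Fin n → 𝓢(EuclideanSpace ℝ (Fin 4), ℝ)) :
    expect (φ g q.1, (Ψ g q.1, ((1 / 2 : ℝ) * g ^ 2, (1 / 2 : ℝ) • q.1))) S n σ f =
      expect (g, q) (M * S) n σ (fun i => blockDilate M (f i)) := by
  by_cases hσ : ∀ i, σ i = r.curvature
  · have hq1 : ‖q.1‖ ≤ R := (norm_fst_le q).trans hq
    rw [h_in g q (M * S) n σ _ hσ hg hq1]
    by_cases himg : φ g q.1 ∈ Set.Icc 0 δ ∧ ‖Ψ g q.1‖ ≤ R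
    · rw [h_in _ _ S n σ f hσ himg.1 himg.2]
      exact hD.corr_step g q.1 hg hq1 himg.1 himg.2 S n f
    · rw [h_out _ _ S n σ f hσ himg]
      have h2 : Real.sqrt (2 * ((1 / 2 : ℝ) * g ^ 2)) = g := by
        rw [show (2 : ℝ) * (1 / 2 * g ^ 2) = g ^ 2 by ring, Real.sqrt_sq hg.1]
      have h3 : (2 : ℝ) • (1 / 2 : ℝ) • q.1 = q.1 := by
        rw [smul_smul, show (2 : ℝ) * (1 / 2) = 1 by norm_num, one_smul]
      simp only [h2, h3]
  · rw [h_mixed _ S n σ f hσ, h_mixed _ (M * S) n σ _ hσ]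

omit [NormedSpace ℝ E] in
include hD h_in h_mixed in
/-- (4b) for the decoded realisation functional: the Wilson points lie in the chart; on curvature
strings `corr_wilson`, on mixed strings both sides vanish. [folklore] -/
private theorem hat_expect_wilson (c : YMSpecies G → ℝ) (hc1 : c r.curvature = 1)
    (hc0 : ∀ s, s ≠ r.curvature → c s = 0) (g : ℝ) (hg : g ∈ Set.Ioc 0 g₀) (L n : ℕ)
    (σ : Fin n → YMSpecies G) (f : Fin n → 𝓢(EuclideanSpace ℝ (Fin 4), ℝ)) :
    expect (g, (yW g, 0)) (2 * L + 1) n σ f = wilsonCentredSchwinger r.ρ (betaOf g) L c n σ f := by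
  by_cases hσ : ∀ i, σ i = r.curvature
  · rw [h_in g (yW g, 0) (2 * L + 1) n σ f hσ ⟨hg.1.le, hg.2.trans hD.g₀_le_δ⟩
      (hD.norm_yW_le g ⟨hg.1.le, hg.2⟩)]
    obtain rfl : σ = fun _ => r.curvature := funext hσ
    exact (hD.corr_wilson g hg L n f).trans
      (wilsonCentredSchwinger_congr_norm r.ρ _ L (fun _ => hc1.symm) f)
  · rw [h_mixed _ _ n σ f hσ]
    obtain ⟨i, hi⟩ := not_forall.mp hσ
    exact (wilsonCentredSchwinger_eq_zero_of_c_zero r.ρ (betaOf g) L c σ f (i := i) (hc0 _ hi)).symm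

omit [NormedSpace ℝ E] in
include hD h_in h_mixed in
/-- (4c) for the decoded realisation functional: on `[0, δ] × B̄_R` every point is in the chart, so
the functional is `corr ∘ (p ↦ (p.1, p.2.1))` there (curvature strings) or `0` (mixed). [folklore] -/
private theorem hat_continuousOn_expect (S n : ℕ) (σ : Fin n → YMSpecies G)
    (f : Fin n → 𝓢(EuclideanSpace ℝ (Fin 4), ℝ))
    (hf : IsOffDiagonal (SchwartzMap.tensorFin n fun i => ofRealTest (f i))) :
    ContinuousOn (fun p : ℝ × (E × (ℝ × E)) => expect p S n σ f)
      (Set.Icc 0 δ ×ˢ Metric.closedBall 0 R) := by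
  by_cases hσ : ∀ i, σ i = r.curvature
  · have hcont : ContinuousOn (fun p : ℝ × (E × (ℝ × E)) => corr (p.1, p.2.1) S n f)
        (Set.Icc 0 δ ×ˢ Metric.closedBall 0 R) := by
      refine (hD.corr_continuousOn S n f hf).comp (f := fun p : ℝ × (E × (ℝ × E)) => (p.1, p.2.1))
        (Continuous.continuousOn (by fun_prop)) fun p hp => ?_
      refine Set.mk_mem_prod (Set.mem_prod.1 hp).1 ?_
      rw [mem_closedBall_zero_iff]
      exact (norm_fst_le p.2).trans (mem_closedBall_zero_iff.1 (Set.mem_prod.1 hp).2)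
    refine hcont.congr fun p hp => ?_
    exact h_in p.1 p.2 S n σ f hσ (Set.mem_prod.1 hp).1
      ((norm_fst_le p.2).trans (mem_closedBall_zero_iff.1 (Set.mem_prod.1 hp).2))
  · exact continuousOn_const.congr fun p _ => h_mixed p S n σ f hσ

end Realisation

/-! ### The stub -/

/-- **Stub 3 of the line `perfect-action-regulator-chart` (realisation transfer).** The verbatim
Lipschitz block `ParabolicBlock` with `b = b₀ log M` (`2 ≤ M`, `0 < b₀`, `‖A‖ ≤ θ < 1`, `0 < C`,
`0 < δ`), the basin clauses `BasinBlock` (`δ ≤ R`, `0 ≤ θ' < 1`) and chart realisation data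
(curvature strings, in-chart covariance, arc identification, chart continuity) inhabit
`BalabanBanachStep G r M`: extend the chart to `E × (ℝ × E)` recording the pre-image `(g²/2, y/2)`,
kill non-curvature species by zero normalisations, and decode the realisation functional outside
the chart from the recorded pre-image. [folklore] -/
theorem stub_realisation :
    ∀ (G : Type) [Group G] [TopologicalSpace G] [IsTopologicalGroup G] [CompactSpace G]
      [MeasurableSpace G] [BorelSpace G] (r : LatticeRep G) (M : ℕ)
      (E : Type) [NormedAddCommGroup E] [NormedSpace ℝ E] [CompleteSpace E]
      (φ : ℝ → E → ℝ) (Ψ : ℝ → E → E) (A : E →L[ℝ] E) (b₀ θ C δ R θ' : ℝ),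
      2 ≤ M → 0 < b₀ → 0 ≤ θ → θ < 1 → ‖A‖ ≤ θ → 0 < C → 0 < δ → δ ≤ R → 0 ≤ θ' → θ' < 1 →
      ParabolicBlock E φ Ψ A (b₀ * Real.log M) C δ →
      BasinBlock E φ Ψ (b₀ * Real.log M) C δ R θ' →
      ∀ (yW : ℝ → E) (g₀ : ℝ) (betaOf : ℝ → ℝ) (κ K : ℝ)
        (corr : ℝ × E → ℕ → (n : ℕ) → (Fin n → 𝓢(EuclideanSpace ℝ (Fin 4), ℝ)) → ℝ),
        ChartRealisationData G r M E φ Ψ δ R yW g₀ betaOf κ K corr →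
        Nonempty (BalabanBanachStep G r M) := by
  intro G _ _ _ _ _ _ r M E _ _ _ φ Ψ A b₀ θ C δ R θ' hM hb₀ hθ hθ1 hA hC hδ hδR hθ' hθ'1 hP hB
    yW g₀ betaOf κ K corr hD
  classical
  -- the linear part on the extended chart
  obtain ⟨Â, hÂ⟩ : ∃ Â : (E × (ℝ × E)) →L[ℝ] (E × (ℝ × E)),
      ∀ q, Â q = (A q.1, (0, (1 / 2 : ℝ) • q.1)) :=
    ⟨(A.comp (ContinuousLinearMap.fst ℝ E (ℝ × E))).prod
      ((0 : (E × (ℝ × E)) →L[ℝ] ℝ).prod ((1 / 2 : ℝ) • ContinuousLinearMap.fst ℝ E (ℝ × E))),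
      fun q => rfl⟩
  -- the normalisations: `1` on the curvature species, `0` elsewhere
  obtain ⟨c, hc1, hc0⟩ : ∃ c : YMSpecies G → ℝ, c r.curvature = 1 ∧ ∀ s, s ≠ r.curvature → c s = 0 :=
    ⟨fun s => if s = r.curvature then 1 else 0, if_pos rfl, fun s hs => if_neg hs⟩
  -- the decoded realisation functional
  obtain ⟨expect, h_in, h_out, h_mixed⟩ : ∃ expect : ℝ × (E × (ℝ × E)) → ℕ → (n : ℕ) →
      (Fin n → YMSpecies G) → (Fin n → 𝓢(EuclideanSpace ℝ (Fin 4), ℝ)) → ℝ,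
      (∀ (g : ℝ) (q : E × (ℝ × E)) (S n : ℕ) (σ : Fin n → YMSpecies G)
        (f : Fin n → 𝓢(EuclideanSpace ℝ (Fin 4), ℝ)), (∀ i, σ i = r.curvature) →
          g ∈ Set.Icc 0 δ → ‖q.1‖ ≤ R → expect (g, q) S n σ f = corr (g, q.1) S n f) ∧
      (∀ (g : ℝ) (q : E × (ℝ × E)) (S n : ℕ) (σ : Fin n → YMSpecies G)
        (f : Fin n → 𝓢(EuclideanSpace ℝ (Fin 4), ℝ)), (∀ i, σ i = r.curvature) →
          ¬ (g ∈ Set.Icc 0 δ ∧ ‖q.1‖ ≤ R) →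
            expect (g, q) S n σ f = corr (Real.sqrt (2 * q.2.1), (2 : ℝ) • q.2.2) (M * S) n
              (fun i => blockDilate M (f i))) ∧
      (∀ (p : ℝ × (E × (ℝ × E))) (S n : ℕ) (σ : Fin n → YMSpecies G)
        (f : Fin n → 𝓢(EuclideanSpace ℝ (Fin 4), ℝ)), ¬ (∀ i, σ i = r.curvature) →
          expect p S n σ f = 0) := by
    refine ⟨fun p S n σ f => if (∀ i, σ i = r.curvature) then
        (if (p.1 ∈ Set.Icc 0 δ ∧ ‖p.2.1‖ ≤ R) then corr (p.1, p.2.1) S n f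
          else corr (Real.sqrt (2 * p.2.2.1), (2 : ℝ) • p.2.2.2) (M * S) n
            (fun i => blockDilate M (f i)))
        else 0, ?_, ?_, ?_⟩
    · intro g q S n σ f hσ hg hq; dsimp only; rw [if_pos hσ, if_pos ⟨hg, hq⟩]
    · intro g q S n σ f hσ hgq; dsimp only; rw [if_pos hσ, if_neg hgq]
    · intro p S n σ f hσ; dsimp only; rw [if_neg hσ]
  have hM1 : (1 : ℝ) < M := by exact_mod_cast hM
  exact ⟨{
    E := E × (ℝ × E)
    φ := fun g q => φ g q.1
    Ψ := fun g q => (Ψ g q.1, ((1 / 2 : ℝ) * g ^ 2, (1 / 2 : ℝ) • q.1))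
    A := Â
    b := b₀ * Real.log M
    θ := max θ (1 / 2)
    C := max C (1 / 2)
    δ := δ
    b_pos := mul_pos hb₀ (Real.log_pos hM1)
    θ_nonneg := le_max_of_le_left hθ
    θ_lt_one := max_lt hθ1 (by norm_num)
    C_pos := lt_max_of_lt_left hC
    δ_pos := hδ
    norm_A_le := hat_norm_A_le hθ hA Â hÂ
    remainder := fun g q hg hq => hat_remainder hP Â hÂ g q hg hq
    lipschitz_fibre := fun g q q' hg hq hq' => hat_lipschitz_fibre hP Â hÂ g q q' hg hq hq'
    lipschitz_base := fun g g' q hg hg' hq => hat_lipschitz_base hP g g' q hg hg' hq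
    b₀ := b₀
    b_eq := rfl
    R := R
    δ_le_R := hδR
    θ' := max θ' (1 / 2)
    θ'_nonneg := le_max_of_le_left hθ'
    θ'_lt_one := max_lt hθ'1 (by norm_num)
    contraction := fun g q q' hg hq hq' => hat_contraction hθ' hB g q q' hg hq hq'
    remainder_basin := fun g q hg hq => hat_remainder_basin hB g q hg hq
    yW := fun g => (yW g, 0)
    g₀ := g₀
    g₀_pos := hD.g₀_pos
    continuousOn_yW := hD.continuousOn_yW.prodMk continuousOn_const
    norm_yW_le := fun g hg => by
      rw [Prod.norm_mk, norm_zero]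
      exact max_le (hD.norm_yW_le g hg) (hδ.le.trans hδR)
    betaOf := betaOf
    strictAntiOn_betaOf := hD.strictAntiOn_betaOf
    continuousOn_betaOf := hD.continuousOn_betaOf
    κ := κ
    κ_pos := hD.κ_pos
    K := K
    betaOf_sub_le := hD.betaOf_sub_le
    c := fun _ => c
    c_curvature := fun _ => hc1
    expect := expect
    expect_step := fun g q hg hq S n σ f =>
      hat_expect_step hD expect h_in h_out h_mixed g q hg hq S n σ f
    expect_wilson := fun g hg L n σ f =>
      hat_expect_wilson hD expect h_in h_mixed c hc1 hc0 g hg L n σ f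
    continuousOn_expect := fun S n σ f hf =>
      hat_continuousOn_expect hD expect h_in h_mixed S n σ f hf }⟩

end Summit.QuantumFields.YangMills.Theorems.BalabanStepParabolic

end
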